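import Mathlib
import HarnessLib
import Summits.HubbardSuperconductivity.HubbardSuperconductivity.Theorems.KLProgrammeKLRegimeVolumeLimitFrameTransfer
import Summits.HubbardSuperconductivity.HubbardSuperconductivity.Theorems.KLProgrammeKLRegimeSplitSlotsV17F
import Summits.HubbardSuperconductivity.HubbardSuperconductivity.Theorems.KLProgrammeKLRegimeFlowPieceJetsOfReadJets
import Summits.HubbardSuperconductivity.HubbardSuperconductivity.Theorems.KLProgrammeKLRegimeCountertermJacksonFrameBounds
import Summits.HubbardSuperconductivity.HubbardSuperconductivity.Theorems.KLProgrammeKLRegimeSplitTwoLegFrameLipschitzFn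
import Summits.HubbardSuperconductivity.HubbardSuperconductivity.Theorems.KLProgrammeKLRegimeSplitFrameExtFnSymmetric

/-!
# The FLOW FRAMES of two volumes agree up to `O(1/L)`, scale by scale, FROM THE V17F TOWER ALONE — hence the gen-7-flow VL child owes only the
# framed nested comparability of the last-scale carriers in the flow's OWN frames
# (seat hubbard-kl-k3c5-p3 g7, VL co-registrant; technique «OS-positivity-free direct assembly»; K3-FLOW RULING F, (K3F) Q-F4 made quantitative)

Scheme F (`…KLRegimeSplitSlotsV17F`, p524744): the frame at scale `n` in the volume `(L, M)` is DEFINED, `K_n^{(L,M)} = klFlowFrameU L M β U μ n`,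
`K_{n+1} = K_n ⊖ 𝒥_{d_n}(E_μ(ν_n^{(L,M)}))` with `ν_n^{(L,M)} = klLocalPart L M β U μ K_n^{(L,M)} n` the scale-`n` reading, `E_μ = klFrameExtFn μ` the tube extension
and `𝒥_d = jacksonFrame d` the Jackson mean.  Both `E_μ` and `𝒥_d` are 1-LIPSCHITZ IN THE SUP NORM (`abs_klFrameExtFn_sub_klFrameExtFn_le`, p2/k3c3;
`abs_jsmooth_sub_jsmooth_le`, k3c3-p2), and the V17F two-leg slot carries (E3f-F) `TwoLegVolumeRateF`: the readings of two volumes, EACH IN ITS OWN FLOW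
FRAME, differ by `≤ Q.CL β n / L`.  Telescoping the recursion:

* §1 `abs_eval_klFlowPieceJackson_sub_le` — two volumes/frames, one scale: `|piece(q) − piece′(q)| ≤ sup_θ |ν − ν′|` (profiles `C⁴`, `μ ∈ klWindowC`);
* §2 `abs_eval_klFlowFrameU_sub_le_sum` — `|K_n^{(L,M)}(q) − K_n^{(L′,M′)}(q)| ≤ Σ_{m<n} |piece_m(q) − piece′_m(q)|`;
* §3 **`flowFrames_twoVolume_of_towerV17F`** — under `TowerP klPredsV17F … Lstar Mstar`: for `Lstar ≤ L ≤ L′`, `M ≥ max (Mstar L) (Q.M0 β L)`,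
  `M′ ≥ max (Mstar L′) (Q.M0 β L′)`, every `n ≤ nScales β + 1` and every `q`: `|K_n^{(L,M)}(q) − K_n^{(L′,M′)}(q)| ≤ (Σ_{m<n} Q.CL β m)/L`
  ((E3f-F)'s antecedent is discharged by the tower at the larger volumes with `Mq := Mstar`); `abs_eval_klFlowFrameU_le_of_towerV17F` — the sup bound
  `|K_n^{(L,M)}(q)| ≤ Σ_{m<n} R.Gfr 0·uPow 0 U·4^{−2m}` from (I-F jets) (`abs_evalM_klFlowFrameU_sub_le`, p2);
* §4 `perLabelBare_of_framedFlow_eventually` — …FrameTransfer's transfer with the frame bound asked only beyond thresholds;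
* §5 **`volumeLimitTextV17F_of_framedNestedFlowText`** — the gen-7-flow VL child text `VolumeLimitP2 klPredsV17F FinalTwoLegVolLimitEx klWindowC` from ONE
  export: for each Matsubara integer `n`, nested same-momentum comparability of the FRAMED last-scale carriers
  `klSelfEnergy L M β U μ (klFlowFrameU L M β U μ (nScales β+1)) klE0 (nScales β+1) (ω,k) 0` vs the same at `L″`, `K^{(L″,M)}` — frame comparability and
  frame bounds are NOT asked: they are theorems of the tower.  («cauchy v8-F» = this text as the stub.)
* §6 (appendix) `abs_eval_klFlowFrameU_sub_le_of_readings`, `abs_eval_klFlowFrameU_le_of_pieceJets` — the same two facts from the HISTORIES below `n`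
  only (no tower), the form consumable inside the engine-flow lineage's own proof of (E3f-F) at scale `n`.

Everything is proved; no definition; nothing is asserted about the model.
-/

noncomputable section

namespace Summit.HubbardSuperconductivity.HubbardSuperconductivity.Theorems.TwoPointAssembly

set_option linter.dupNamespace false -- summit = problem name (single-conjunct summit), D-0017

open Finset Filter Topology Literature.MathematicalPhysics.QuantumLattice Literature.Probability.LatticeModels GrassmannAlgebra
open Literature.MathematicalPhysics.QuantumLattice.FermiRG
open Summit.HubbardSuperconductivity.HubbardSuperconductivity.Theorems.DispersionFlow
open Summit.HubbardSuperconductivity.HubbardSuperconductivity.Theorems.KLRegimeSplit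
open Summit.HubbardSuperconductivity.HubbardSuperconductivity.Theorems.KLProgrammeLegKernels

/-! ## §1 One scale: the Jackson piece is 1-Lipschitz in the reading -/

/-- A frame function whose `Momentum` lift is `Cᵐ` is continuous. -/
private theorem continuous_of_contDiff_onM_fn' {P : FrameFn} {m : WithTop ℕ∞} (h : ContDiff ℝ m (onM P)) : Continuous P := by
  have hK : P = fun p : Fin 2 → ℝ => onM P (WithLp.toLp 2 p) := by funext p; simp [onM]
  rw [hK]
  exact h.continuous.comp (PiLp.continuous_toLp 2 _)

/-- **One scale, two volumes/frames: `|piece(q) − piece′(q)| ≤ sup_θ|ν − ν′|`.**  The Jackson piece `𝒥_{d_m}(E_μ(ν))` of a `C⁴` reading `ν` (at any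
frame, volume, cutoff) is 1-Lipschitz in `ν` for the sup norms (`μ ∈ klWindowC`): `E_μ` is 1-Lipschitz (`abs_klFrameExtFn_sub_klFrameExtFn_le`) and the
Jackson mean is a positive kernel of mass one (`abs_jsmooth_sub_jsmooth_le`, through the frame presentation `eval_jacksonFrame` of symmetric frames). -/
theorem abs_eval_klFlowPieceJackson_sub_le {L M L' M' : ℕ} [NeZero L] [NeZero M] [NeZero L'] [NeZero M'] {β U μ : ℝ} (hμ : μ ∈ klWindowC)
    {K K' : TrigPolyC4v} (m : ℕ)
    (hc : ContDiff ℝ 4 (fun θ : ℝ => klLocalPart L M β U μ K m θ)) (hc' : ContDiff ℝ 4 (fun θ : ℝ => klLocalPart L' M' β U μ K' m θ))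
    {δ : ℝ} (hδ : ∀ θ, |klLocalPart L M β U μ K m θ - klLocalPart L' M' β U μ K' m θ| ≤ δ) (q : Fin 2 → ℝ) :
    |(klFlowPieceJackson L M β U μ m K).eval q - (klFlowPieceJackson L' M' β U μ m K').eval q| ≤ δ := by
  obtain ⟨hper, hrefl, hswap⟩ := klFrameExtFn_localPart_symmetric (L := L) (M := M) β U μ K m hμ
  obtain ⟨hper', hrefl', hswap'⟩ := klFrameExtFn_localPart_symmetric (L := L') (M := M') β U μ K' m hμ
  have hcont : Continuous (klFrameExtFn μ (fun θ : ℝ => klLocalPart L M β U μ K m θ)) :=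
    continuous_of_contDiff_onM_fn' (contDiff_onM_klFrameExtFn hc (klLocalPart_periodic β U μ K m) hμ)
  have hcont' : Continuous (klFrameExtFn μ (fun θ : ℝ => klLocalPart L' M' β U μ K' m θ)) :=
    continuous_of_contDiff_onM_fn' (contDiff_onM_klFrameExtFn hc' (klLocalPart_periodic β U μ K' m) hμ)
  have hi : IntervalIntegrable (fun θ : ℝ => klLocalPart L M β U μ K m θ) MeasureTheory.volume 0 (2 * Real.pi) :=
    hc.continuous.intervalIntegrable _ _
  have hi' : IntervalIntegrable (fun θ : ℝ => klLocalPart L' M' β U μ K' m θ) MeasureTheory.volume 0 (2 * Real.pi) :=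
    hc'.continuous.intervalIntegrable _ _
  have hext : ∀ p : Fin 2 → ℝ, |klFrameExtFn μ (fun θ : ℝ => klLocalPart L M β U μ K m θ) p -
      klFrameExtFn μ (fun θ : ℝ => klLocalPart L' M' β U μ K' m θ) p| ≤ δ :=
    fun p => abs_klFrameExtFn_sub_klFrameExtFn_le μ hi hi' hδ p
  rw [klFlowPieceJackson, klFlowPieceJackson, eval_jacksonFrame hcont hper hrefl hswap, eval_jacksonFrame hcont' hper' hrefl' hswap']
  exact abs_jsmooth_sub_jsmooth_le _ hcont hcont' hext q

/-! ## §2 Telescoping the flow recursion -/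

/-- **`|K_n^{(L,M)}(q) − K_n^{(L′,M′)}(q)| ≤ Σ_{m<n} |piece_m(q) − piece′_m(q)|`** (`K_n = −Σ_{m<n} piece_m`, `eval_klFlowFrameU`). -/
theorem abs_eval_klFlowFrameU_sub_le_sum {L M L' M' : ℕ} [NeZero L] [NeZero M] [NeZero L'] [NeZero M'] (β U μ : ℝ) (n : ℕ) {δ : ℕ → ℝ}
    (q : Fin 2 → ℝ) (h : ∀ m < n, |(klFlowPiece L M β U μ m).eval q - (klFlowPiece L' M' β U μ m).eval q| ≤ δ m) :
    |(klFlowFrameU L M β U μ n).eval q - (klFlowFrameU L' M' β U μ n).eval q| ≤ ∑ m ∈ range n, δ m := by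
  rw [eval_klFlowFrameU, eval_klFlowFrameU, neg_sub_neg, abs_sub_comm, ← Finset.sum_sub_distrib]
  exact (Finset.abs_sum_le_sum_abs _ _).trans (Finset.sum_le_sum fun m hm => h m (Finset.mem_range.1 hm))

/-! ## §3 From the V17F tower: two-volume agreement and a sup bound of the flow frames, scale by scale -/

section Tower

variable {G : GeoConsts} {P : SplitConsts} {Q : EngConsts} {R : RenConsts} {β U μ : ℝ} {K₀ : TrigPolyC4v} {Lstar : ℕ} {Mstar : ℕ → ℕ}

/-- **The flow frames of two volumes agree up to `(Σ_{m<n} Q.CL β m)/L`, FROM THE TOWER.**  Under `TowerP klPredsV17F G P Q R β U μ K₀ Lstar Mstar`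
(`μ ∈ klWindowC`): for `Lstar ≤ L ≤ L′`, `Mstar L ≤ M`, `Q.M0 β L ≤ M`, `Mstar L′ ≤ M′`, `Q.M0 β L′ ≤ M′`, every `n ≤ nScales β + 1` and every
momentum `q`, `|K_n^{(L,M)}(q) − K_n^{(L′,M′)}(q)| ≤ (Σ_{m<n} Q.CL β m)/L`.  Per scale `m < n`: (E3f-F) at `(L, M, m)` with the reader's threshold
`Mq := Mstar` — its history antecedent at every larger volume is the tower itself (split, renorm, engine, reading jets, slopes at `j < m`) — gives
`sup_θ|ν_m^{(L,M)} − ν_m^{(L′,M′)}| ≤ Q.CL β m / L`; §1 passes it to the pieces (the readings are `C⁴` by (E3a-F) `TwoLegReadJetsF`); §2 sums. -/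
theorem flowFrames_twoVolume_of_towerV17F (hμ : μ ∈ klWindowC) (hT : TowerP klPredsV17F G P Q R β U μ K₀ Lstar Mstar)
    {L : ℕ} [NeZero L] (hL : Lstar ≤ L) {L' : ℕ} [NeZero L'] (hLL' : L ≤ L')
    {M : ℕ} [NeZero M] (hM₁ : Mstar L ≤ M) (hM₂ : Q.M0 β L ≤ M) {M' : ℕ} [NeZero M'] (hM'₁ : Mstar L' ≤ M') (hM'₂ : Q.M0 β L' ≤ M')
    {n : ℕ} (hn : n ≤ nScales β + 1) (q : Fin 2 → ℝ) :
    |(klFlowFrameU L M β U μ n).eval q - (klFlowFrameU L' M' β U μ n).eval q| ≤ (∑ m ∈ range n, Q.CL β m) / L := by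
  have hL' : Lstar ≤ L' := hL.trans hLL'
  -- the tower at the two volumes
  have hTL := hT L M hL hM₁
  have hTL' := hT L' M' hL' hM'₁
  rw [Finset.sum_div]
  refine abs_eval_klFlowFrameU_sub_le_sum β U μ n q fun m hm => ?_
  have hm' : m ≤ nScales β := by omega
  -- the two-leg slots at scale `m` of both volumes
  have h2 : TwoLegStepV17F L M G P Q R β U μ m := (hTL.1 m hm').2.2.2
  have h2' : TwoLegStepV17F L' M' G P Q R β U μ m := (hTL'.1 m hm').2.2.2
  obtain ⟨hread, -, hrate⟩ := h2
  obtain ⟨hread', -, -⟩ := h2'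
  -- (E3f-F) at `(L, M, m)` with `Mq := Mstar`: the history antecedent from the tower at every larger volume
  have hhist : ∀ (L₂ M₂ : ℕ) [NeZero L₂] [NeZero M₂], L ≤ L₂ → Q.M0 β L₂ ≤ M₂ → Mstar L₂ ≤ M₂ →
      ∀ j < m, histV17F L₂ M₂ G P Q R β U μ j ∧ TwoLegSlopes L₂ M₂ R β U μ (klFlowFrameU L₂ M₂ β U μ j) j := by
    intro L₂ M₂ _ _ hL₂ _ hM₂ j hj
    have hj' : j ≤ nScales β := by omega
    obtain ⟨hren, hspl, heng, htwo⟩ := (hT L₂ M₂ (hL.trans hL₂) hM₂).1 j hj'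
    have htwo' : TwoLegStepV17F L₂ M₂ G P Q R β U μ j := htwo
    exact ⟨⟨hspl, hren, heng, htwo'.1⟩, htwo'.2.1⟩
  have hν : ∀ θ : ℝ, |klLocalPart L M β U μ (klFlowFrameU L M β U μ m) m θ - klLocalPart L' M' β U μ (klFlowFrameU L' M' β U μ m) m θ| ≤
      Q.CL β m / L :=
    hrate Mstar hM₂ hM₁ hhist L' M' hLL' hM'₂ hM'₁
  exact abs_eval_klFlowPieceJackson_sub_le hμ m hread.1 hread'.1 hν q

/-- **Sup bound of the flow frames from the tower**: `|K_n^{(L,M)}(q)| ≤ Σ_{m<n} R.Gfr 0·uPow 0 U·4^{−2m}` for `Lstar ≤ L`, `Mstar L ≤ M`,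
`n ≤ nScales β + 1` ((I-F jets) of the renormalisation slot at every `m < n`; p2's `abs_evalM_klFlowFrameU_sub_le` against `K_0 = 0`). -/
theorem abs_eval_klFlowFrameU_le_of_towerV17F (hT : TowerP klPredsV17F G P Q R β U μ K₀ Lstar Mstar)
    {L : ℕ} [NeZero L] (hL : Lstar ≤ L) {M : ℕ} [NeZero M] (hM : Mstar L ≤ M) {n : ℕ} (hn : n ≤ nScales β + 1) (q : Fin 2 → ℝ) :
    |(klFlowFrameU L M β U μ n).eval q| ≤ ∑ m ∈ range n, R.Gfr 0 * uPow 0 U * (4 : ℝ) ^ ((((0 : ℕ) : ℤ) - 2) * (m : ℤ)) := by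
  have hTL := hT L M hL hM
  have hJ : ∀ m < n, FlowPieceJetsAt L M β U μ R m := by
    intro m hm
    have hm' : m ≤ nScales β := by omega
    have hren : RenormFlowAtV17F L M β U μ R m := (hTL.1 m hm').1
    exact hren.2.1
  have h := abs_evalM_klFlowFrameU_sub_le (Nat.zero_le n) hJ (WithLp.toLp 2 q)
  rw [klFlowFrameU_zero, Finset.range_eq_Ico] at *
  simpa [evalM_apply] using h

end Tower

/-! ## §4 The frame transfer with the frame bound asked only beyond thresholds -/

section Flow

variable {β U : ℝ}

/-- `perLabelBare_of_framedFlow` (…FrameTransfer) with the frame family defined on positive volumes/cutoffs only (`[NeZero L] [NeZero M]`, as the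
flow frames are) and the sup bound `|Kf L M (q)| ≤ Kmax` required only for `L ≥ Lb`, `M ≥ Mb L` (absorbed into the thresholds of the conclusion). -/
theorem perLabelBare_of_framedFlow_eventually (hβ : 0 < β) (hU : U ≠ 0) (μ : ℝ) (n : ℤ)
    (Kf : (L M : ℕ) → [NeZero L] → [NeZero M] → TrigPolyC4v) {Kmax : ℝ} (hKmax : 0 ≤ Kmax)
    (hKf : ∃ Lb : ℕ, ∃ Mb : ℕ → ℕ, ∀ (L : ℕ) [NeZero L], Lb ≤ L → ∀ (M : ℕ) [NeZero M], Mb L ≤ M → ∀ q : Fin 2 → ℝ, |(Kf L M).eval q| ≤ Kmax)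
    (hS : ∃ L₀ : ℕ, ∃ ρ : ℕ → ℝ, Tendsto ρ atTop (𝓝 0) ∧
      ∀ (L : ℕ) [NeZero L], L₀ ≤ L → ∀ (L'' : ℕ) [NeZero L''], L ∣ L'' → ∃ M₀ : ℕ, ∀ (M : ℕ) [NeZero M], M₀ ≤ M →
        ∀ (ω : MatsubaraIdx M), matsubaraInt M ω = n → ∀ (k : TorusSite 2 L) (k'' : TorusSite 2 L''),
          latticeMomentum L'' k'' = latticeMomentum L k →
            ‖klSelfEnergy L M β U μ (Kf L M) klE0 (nScales β + 1) (ω, k) 0 -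
                klSelfEnergy L'' M β U μ (Kf L'' M) klE0 (nScales β + 1) (ω, k'') 0‖ ≤ ρ L)
    (hF : ∃ L₀ : ℕ, ∃ ρ : ℕ → ℝ, Tendsto ρ atTop (𝓝 0) ∧
      ∀ (L : ℕ) [NeZero L], L₀ ≤ L → ∀ (L'' : ℕ) [NeZero L''], L ∣ L'' → ∃ M₀ : ℕ, ∀ (M : ℕ) [NeZero M], M₀ ≤ M →
        ∀ k : TorusSite 2 L, |(Kf L M).eval (latticeMomentum L k) - (Kf L'' M).eval (latticeMomentum L k)| ≤ ρ L) :
    ∃ L₀ : ℕ, ∃ ρ : ℕ → ℝ, Tendsto ρ atTop (𝓝 0) ∧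
      ∀ (L : ℕ) [NeZero L], L₀ ≤ L → ∀ (L'' : ℕ) [NeZero L''], L ∣ L'' → ∃ M₀ : ℕ, ∀ (M : ℕ) [NeZero M], M₀ ≤ M →
        ∀ (ω : MatsubaraIdx M), matsubaraInt M ω = n → ∀ (k : TorusSite 2 L) (k'' : TorusSite 2 L''),
          latticeMomentum L'' k'' = latticeMomentum L k →
            ‖klSelfEnergy L M β U μ 0 klE0 (nScales β + 1) (ω, k) 0 -
                klSelfEnergy L'' M β U μ 0 klE0 (nScales β + 1) (ω, k'') 0‖ ≤ ρ L := by
  obtain ⟨L₁, ρ₁, hρ₁, hS⟩ := hS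
  obtain ⟨L₂, ρ₂, hρ₂, hF⟩ := hF
  obtain ⟨Lb, Mb, hKf⟩ := hKf
  have hBb0 : (0 : ℝ) ≤ 3 / 2 * |U| + 9 / 4 * β * U ^ 2 + 1 := by positivity
  have hA0 : (0 : ℝ) ≤ (1 + Kmax * (β / Real.pi)) ^ 2 := by positivity
  have hC0 : (0 : ℝ) ≤ ((1 + Kmax * (β / Real.pi)) +
      (2 * (1 + Kmax * (β / Real.pi)) * ((1 + Kmax * (β / Real.pi)) ^ 2 * (3 / 2 * |U| + 9 / 4 * β * U ^ 2 + 1) +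
        Kmax * (1 + Kmax * (β / Real.pi))) + Kmax) * (β / Real.pi) * (1 + Kmax * (β / Real.pi))) := by positivity
  refine ⟨max (max L₁ L₂) (max 3 Lb), fun L => (1 + Kmax * (β / Real.pi)) ^ 2 * ρ₁ L +
      ((1 + Kmax * (β / Real.pi)) +
        (2 * (1 + Kmax * (β / Real.pi)) * ((1 + Kmax * (β / Real.pi)) ^ 2 * (3 / 2 * |U| + 9 / 4 * β * U ^ 2 + 1) +
          Kmax * (1 + Kmax * (β / Real.pi))) + Kmax) * (β / Real.pi) * (1 + Kmax * (β / Real.pi))) * ρ₂ L, ?_,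
    fun L _ hL L'' _ hdvd => ?_⟩
  · simpa using (hρ₁.const_mul ((1 + Kmax * (β / Real.pi)) ^ 2)).add
      (hρ₂.const_mul ((1 + Kmax * (β / Real.pi)) +
        (2 * (1 + Kmax * (β / Real.pi)) * ((1 + Kmax * (β / Real.pi)) ^ 2 * (3 / 2 * |U| + 9 / 4 * β * U ^ 2 + 1) +
          Kmax * (1 + Kmax * (β / Real.pi))) + Kmax) * (β / Real.pi) * (1 + Kmax * (β / Real.pi))))
  have hL1 : L₁ ≤ L := (le_max_left _ _).trans ((le_max_left _ _).trans hL)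
  have hL2 : L₂ ≤ L := (le_max_right _ _).trans ((le_max_left _ _).trans hL)
  have hL3 : 3 ≤ L := (le_max_left _ _).trans ((le_max_right _ _).trans hL)
  have hLb : Lb ≤ L := (le_max_right _ _).trans ((le_max_right _ _).trans hL)
  have hLL'' : L ≤ L'' := Nat.le_of_dvd (Nat.pos_of_ne_zero (NeZero.ne L'')) hdvd
  have hL3'' : 3 ≤ L'' := hL3.trans hLL''
  have hLb'' : Lb ≤ L'' := hLb.trans hLL''
  obtain ⟨M₁, hM₁⟩ := hS L hL1 L'' hdvd
  obtain ⟨M₂, hM₂⟩ := hF L hL2 L'' hdvd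
  obtain ⟨M₃, hM₃⟩ := Filter.eventually_atTop.1 ((tendsto_effPartitionFn_klDInf hL3 hβ U μ).eventually_ne (klDInf_ne_zero β U μ))
  obtain ⟨M₄, hM₄⟩ := Filter.eventually_atTop.1 ((tendsto_effPartitionFn_klDInf hL3'' hβ U μ).eventually_ne (klDInf_ne_zero β U μ))
  obtain ⟨M₅, hM₅⟩ := eventually_norm_klSelfEnergy_le_of_inf_bound hL3'' hβ U μ 0 (fun n' p => norm_klSelfEnergyInf_zero_le hL3'' hβ hU μ n' p)
  refine ⟨max (max (max M₁ M₂) (max M₃ M₄)) (max M₅ (max (Mb L) (Mb L''))), fun M _ hM ω hω k k'' hkk => ?_⟩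
  have hMM₁ : M₁ ≤ M := (le_max_left _ _).trans ((le_max_left _ _).trans ((le_max_left _ _).trans hM))
  have hMM₂ : M₂ ≤ M := (le_max_right _ _).trans ((le_max_left _ _).trans ((le_max_left _ _).trans hM))
  have hMM₃ : M₃ ≤ M := (le_max_left _ _).trans ((le_max_right _ _).trans ((le_max_left _ _).trans hM))
  have hMM₄ : M₄ ≤ M := (le_max_right _ _).trans ((le_max_right _ _).trans ((le_max_left _ _).trans hM))
  have hMM₅ : M₅ ≤ M := (le_max_left _ _).trans ((le_max_right _ _).trans hM)
  have hMb : Mb L ≤ M := (le_max_left _ _).trans ((le_max_right _ _).trans ((le_max_right _ _).trans hM))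
  have hMb'' : Mb L'' ≤ M := (le_max_right _ _).trans ((le_max_right _ _).trans ((le_max_right _ _).trans hM))
  have hD := hM₃ M hMM₃
  have hD'' := hM₄ M hMM₄
  have h₁ := klSelfEnergy_frame_dressing hβ U μ (Kf L M) hD ω k 0
  have h₂ := klSelfEnergy_frame_dressing hβ U μ (Kf L'' M) hD'' ω k'' 0
  rw [hkk, hω] at h₂
  rw [hω] at h₁
  have hest := norm_bare_sub_bare_le_of_framed hβ μ n (latticeMomentum L k) hKmax hBb0 (hKf L hLb M hMb _) (hKf L'' hLb'' M hMb'' _) h₁ h₂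
    (hM₅ M hMM₅ (ω, k'') 0)
  refine hest.trans ?_
  exact add_le_add (mul_le_mul_of_nonneg_left (hM₁ M hMM₁ ω hω k k'' hkk) hA0) (mul_le_mul_of_nonneg_left (hM₂ M hMM₂ k) hC0)

end Flow

/-! ## §5 The gen-7-flow VL child from ONE export: framed nested comparability in the flow's own frames -/

/-- `klPredsV17F.frameOK ⇒ FrameOK` (the (T-a) conjunct of the dummy frame class). -/
theorem klPredsV17F_frameOK_frameOK (R : RenConsts) (U : ℝ) (N : ℕ) (μ : ℝ) (K : TrigPolyC4v) (h : klPredsV17F.frameOK R U N μ K) :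
    FrameOK R U N μ K := ((klPredsV17F_frameOK_iff R U N μ K).1 h).2

/-- **THE GEN-7-FLOW VL CHILD FROM THE FLOW LINEAGE'S OWN-FRAME EXPORT ALONE** («cauchy v8-F»): the child text
`VolumeLimitP2 klPredsV17F FinalTwoLegVolLimitEx klWindowC` follows from — inside the regime binders, for each Matsubara integer `n` — nested
same-momentum comparability, with a label-dependent threshold and rate, of the FRAMED last-scale carriers
`klSelfEnergy L M β U μ (klFlowFrameU L M β U μ (nScales β + 1)) klE0 (nScales β + 1) (ω,k) 0` and
`klSelfEnergy L″ M β U μ (klFlowFrameU L″ M β U μ (nScales β + 1)) klE0 (nScales β + 1) (ω,k″) 0` (`L ∣ L″`, same cutoff, `matsubaraInt M ω = n`).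
The comparability and boundedness of the two volumes' flow frames are supplied by the tower (§3); the bare text follows by …FrameTransfer. -/
theorem volumeLimitTextV17F_of_framedNestedFlowText
    (hS : ∀ (G : GeoConsts) (P : SplitConsts) (Q : EngConsts) (R : RenConsts), G.WF → P.WF → Q.WF → R.WF →
      ∃ c₅ : ℝ, 0 < c₅ ∧ ∀ c : ℝ, 0 < c → c ≤ c₅ → ∃ U₀ : ℝ, 0 < U₀ ∧
        ∀ μ ∈ klWindowC, ∀ U : ℝ, 0 < U → U ≤ U₀ → ∀ β : ℝ, klBetaMin ≤ β → β ≤ Real.exp (c / U ^ 2) →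
          ∀ K : TrigPolyC4v, klPredsV17F.frameOK R U (nScales β) μ K →
            ∀ (Lstar : ℕ) (Mstar : ℕ → ℕ), TowerP klPredsV17F G P Q R β U μ K Lstar Mstar →
              ∀ n : ℤ, ∃ L₀ : ℕ, ∃ ρ : ℕ → ℝ, Tendsto ρ atTop (𝓝 0) ∧
                ∀ (L : ℕ) [NeZero L], L₀ ≤ L → ∀ (L'' : ℕ) [NeZero L''], L ∣ L'' → ∃ M₀ : ℕ, ∀ (M : ℕ) [NeZero M], M₀ ≤ M →
                  ∀ (ω : MatsubaraIdx M), matsubaraInt M ω = n → ∀ (k : TorusSite 2 L) (k'' : TorusSite 2 L''),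
                    latticeMomentum L'' k'' = latticeMomentum L k →
                      ‖klSelfEnergy L M β U μ (klFlowFrameU L M β U μ (nScales β + 1)) klE0 (nScales β + 1) (ω, k) 0 -
                          klSelfEnergy L'' M β U μ (klFlowFrameU L'' M β U μ (nScales β + 1)) klE0 (nScales β + 1) (ω, k'') 0‖ ≤ ρ L) :
    VolumeLimitP2 klPredsV17F FinalTwoLegVolLimitEx klWindowC := by
  refine volumeLimitP2_of_perLabelThresholdsOnlyText klPredsV17F klWindowC klPredsV17F_frameOK_frameOK ?_
  intro G P Q R hG hP hQ hR
  obtain ⟨c₅, hc₅, hc⟩ := hS G P Q R hG hP hQ hR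
  refine ⟨c₅, hc₅, fun c hc0 hcc => ?_⟩
  obtain ⟨U₀, hU₀, hU⟩ := hc c hc0 hcc
  refine ⟨U₀, hU₀, fun μ hμ U hU0 hUU β hβmin hβmax K hK Lstar Mstar hT n => ?_⟩
  have hβ : 0 < β := pos_of_klBetaMin_le hβmin
  have hSn := hU μ hμ U hU0 hUU β hβmin hβmax K hK Lstar Mstar hT n
  -- the frame family: the flow frames at the last scale; `Kmax := max 0 (Σ_{m ≤ n_β} Gfr 0·uPow 0 U·4^{−2m})`
  refine perLabelBare_of_framedFlow_eventually hβ hU0.ne' μ n (fun L M _ _ => klFlowFrameU L M β U μ (nScales β + 1))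
    (Kmax := max 0 (∑ m ∈ range (nScales β + 1), R.Gfr 0 * uPow 0 U * (4 : ℝ) ^ ((((0 : ℕ) : ℤ) - 2) * (m : ℤ)))) (le_max_left _ _) ?_ hSn ?_
  · -- (o) the sup bound beyond the tower thresholds
    refine ⟨Lstar, Mstar, fun L _ hL M _ hM q => ?_⟩
    exact (abs_eval_klFlowFrameU_le_of_towerV17F hT hL hM le_rfl q).trans (le_max_right _ _)
  · -- (ii) frame comparability on the coarse grid, rate `(Σ_{m ≤ n_β} Q.CL β m)/L`
    refine ⟨Lstar, fun L => (∑ m ∈ range (nScales β + 1), Q.CL β m) / L, tendsto_const_div_atTop_nhds_zero_nat _,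
      fun L _ hL L'' _ hdvd => ?_⟩
    have hLL'' : L ≤ L'' := Nat.le_of_dvd (Nat.pos_of_ne_zero (NeZero.ne L'')) hdvd
    refine ⟨max (max (Mstar L) (Mstar L'')) (max (Q.M0 β L) (Q.M0 β L'')), fun M _ hM k => ?_⟩
    exact flowFrames_twoVolume_of_towerV17F hμ hT hL hLL'' ((le_max_left _ _).trans ((le_max_left _ _).trans hM))
      ((le_max_left _ _).trans ((le_max_right _ _).trans hM)) ((le_max_right _ _).trans ((le_max_left _ _).trans hM))
      ((le_max_right _ _).trans ((le_max_right _ _).trans hM)) le_rfl _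

/-! ## §6 (Appendix) The history-level form, for use INSIDE the engine-flow induction -/

/-- **Frame comparability from the two-leg HISTORY below `n`, no tower** (the form consumable inside stub (e)'s proof of (E3f-F) at scale `n`, where only the
histories `j < n` of the two volumes are in hand): if at every scale `m < n` the readings of the volumes `(L,M)` and `(L′,M′)`, each in its own flow
frame, are `C⁴` ((E3a-F) `TwoLegReadJetsF` of the two histories) and differ by at most `δ m` in the sup norm (the (E3f-F) rates of the history), then
`|K_n^{(L,M)}(q) − K_n^{(L′,M′)}(q)| ≤ Σ_{m<n} δ m` at every momentum (`μ ∈ klWindowC`). -/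
theorem abs_eval_klFlowFrameU_sub_le_of_readings {L M L' M' : ℕ} [NeZero L] [NeZero M] [NeZero L'] [NeZero M'] {G : GeoConsts} {Q : EngConsts}
    {β U μ : ℝ} (hμ : μ ∈ klWindowC) {n : ℕ} {δ : ℕ → ℝ}
    (hread : ∀ m < n, TwoLegReadJetsF L M G Q β U μ m) (hread' : ∀ m < n, TwoLegReadJetsF L' M' G Q β U μ m)
    (hν : ∀ m < n, ∀ θ : ℝ,
      |klLocalPart L M β U μ (klFlowFrameU L M β U μ m) m θ - klLocalPart L' M' β U μ (klFlowFrameU L' M' β U μ m) m θ| ≤ δ m)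
    (q : Fin 2 → ℝ) :
    |(klFlowFrameU L M β U μ n).eval q - (klFlowFrameU L' M' β U μ n).eval q| ≤ ∑ m ∈ range n, δ m :=
  abs_eval_klFlowFrameU_sub_le_sum β U μ n q fun m hm =>
    abs_eval_klFlowPieceJackson_sub_le hμ m (hread m hm).1 (hread' m hm).1 (hν m hm) q

/-- **Sup bound of the flow frame from the renormalisation HISTORY below `n`, no tower**: `|K_n^{(L,M)}(q)| ≤ Σ_{m<n} R.Gfr 0·uPow 0 U·4^{−2m}` from
(I-F jets) at every `m < n` (p2's `abs_evalM_klFlowFrameU_sub_le` against `K_0 = 0`). -/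
theorem abs_eval_klFlowFrameU_le_of_pieceJets {L M : ℕ} [NeZero L] [NeZero M] {β U μ : ℝ} {R : RenConsts} {n : ℕ}
    (hJ : ∀ m < n, FlowPieceJetsAt L M β U μ R m) (q : Fin 2 → ℝ) :
    |(klFlowFrameU L M β U μ n).eval q| ≤ ∑ m ∈ range n, R.Gfr 0 * uPow 0 U * (4 : ℝ) ^ ((((0 : ℕ) : ℤ) - 2) * (m : ℤ)) := by
  have h := abs_evalM_klFlowFrameU_sub_le (Nat.zero_le n) hJ (WithLp.toLp 2 q)
  rw [klFlowFrameU_zero, Finset.range_eq_Ico] at *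
  simpa [evalM_apply] using h

end Summit.HubbardSuperconductivity.HubbardSuperconductivity.Theorems.TwoPointAssembly

end
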